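import Mathlib
import Literature.NumberTheory.LFunctions.WeilOddGroundState
import Summits.RiemannHypothesis.RiemannHypothesis.Theorems.WeilParityEvenWinsBeyondArchFrontier72OfOddLower
import Summits.RiemannHypothesis.RiemannHypothesis.Theorems.WeilGroundStateGroundStateSimpleEvenTrialUpperM72
import Summits.RiemannHypothesis.RiemannHypothesis.Theorems.GroundBartaEvenWinsBeyondArchUpper75
import Summits.RiemannHypothesis.RiemannHypothesis.Theorems.WeilGroundStateGroundStateSimpleEvenCellTransfer
import HarnessLib

/-!
# The parity ladder beyond `log 2`: the cells `[18/25, 3/4]` and `[3/4, 77/100]` from odd-sector lower bounds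

Route WeilParity item `NoParityCrossing` (stmt-RiemannHypothesis-18085; stub `stub_tailSimpleEven`) ≡ GroundBarta rung 4
(`EvenWinsBeyondArch`, stmt-RiemannHypothesis-18807).  Pure logic, RH-free, no named facts.  Prover A (gen 2).

With the landed U-sides `trialUpperM72 : ε(18/25) ≤ 1/(8·10¹²)` and `trialUpper75 : ε(3/4) ≤ 1/(14·10¹²)`, the cell transfer
`GroundStateSimpleEven.weilWindowSimpleEven_on_cell_of_le` reduces the next two cells of the ladder to ONE odd-sector lower
bound each: `1/(8·10¹²) < L ≤ ε_od(3/4)` for `[18/25, 3/4]` and `1/(14·10¹²) < L ≤ ε_od(77/100)` for `[3/4, 77/100]`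
(the deflated Temple L-sides of the certificates M75Y / M77Y).  Chained with `weilWindowSimpleEven_of_le_M72_of_oddLower`
this gives `WeilWindowSimpleEven` on `(0, 3/4]` resp. `(0, 77/100]` from the three resp. four L-sides.
-/

set_option linter.dupNamespace false

noncomputable section

open Set MeasureTheory

namespace Summit.RiemannHypothesis.RiemannHypothesis.Theorems.EvenWinsBeyondArch

open Literature.NumberTheory.LFunctions

/-- **The cell `[18/25, 3/4]`**: `1/(8·10¹²) < L ≤ ε_od(3/4) ⟹ WeilWindowSimpleEven a` for `a ∈ [18/25, 3/4]`. [folklore] -/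
theorem weilWindowSimpleEven_on_cell_M75_of_oddLower {L : ℝ} (hUL : (1 / 8000000000000 : ℝ) < L)
    (hL : L ≤ weilOddGroundEnergy (3 / 4 : ℝ)) {a : ℝ} (hlo : (18 / 25 : ℝ) ≤ a) (hhi : a ≤ 3 / 4) :
    WeilWindowSimpleEven a :=
  GroundStateSimpleEven.weilWindowSimpleEven_on_cell_of_le (b := (18 / 25 : ℝ)) (c := (3 / 4 : ℝ)) (by norm_num) hUL
    trialUpperM72 (fun _ hg hs hn ho ↦ hL.trans (weilOddGroundEnergy_le hg hs ho hn)) hlo hhi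

/-- **`WeilWindowSimpleEven` on `(0, 3/4]`** from the two odd-sector lower bounds at `18/25` and `3/4`. [folklore] -/
theorem weilWindowSimpleEven_of_le_M75_of_oddLower {L₁ L₂ : ℝ} (hUL₁ : (1 / 100000000000 : ℝ) < L₁)
    (hL₁ : L₁ ≤ weilOddGroundEnergy (18 / 25 : ℝ)) (hUL₂ : (1 / 8000000000000 : ℝ) < L₂)
    (hL₂ : L₂ ≤ weilOddGroundEnergy (3 / 4 : ℝ)) :
    ∀ a : ℝ, 0 < a → a ≤ 3 / 4 → WeilWindowSimpleEven a := by
  intro a ha hle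
  rcases le_or_gt a (18 / 25) with h | h
  · exact weilWindowSimpleEven_of_le_M72_of_oddLower hUL₁ hL₁ a ha h
  · exact weilWindowSimpleEven_on_cell_M75_of_oddLower hUL₂ hL₂ h.le hle

/-- **The cell `[3/4, 77/100]`**: `1/(14·10¹²) < L ≤ ε_od(77/100) ⟹ WeilWindowSimpleEven a` for `a ∈ [3/4, 77/100]`. [folklore] -/
theorem weilWindowSimpleEven_on_cell_M77_of_oddLower {L : ℝ} (hUL : (1 / 14000000000000 : ℝ) < L)
    (hL : L ≤ weilOddGroundEnergy (77 / 100 : ℝ)) {a : ℝ} (hlo : (3 / 4 : ℝ) ≤ a) (hhi : a ≤ 77 / 100) :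
    WeilWindowSimpleEven a :=
  GroundStateSimpleEven.weilWindowSimpleEven_on_cell_of_le (b := (3 / 4 : ℝ)) (c := (77 / 100 : ℝ)) (by norm_num) hUL
    trialUpper75 (fun _ hg hs hn ho ↦ hL.trans (weilOddGroundEnergy_le hg hs ho hn)) hlo hhi

/-- **`WeilWindowSimpleEven` on `(0, 77/100]`** from the three odd-sector lower bounds. [folklore] -/
theorem weilWindowSimpleEven_of_le_M77_of_oddLower {L₁ L₂ L₃ : ℝ} (hUL₁ : (1 / 100000000000 : ℝ) < L₁)
    (hL₁ : L₁ ≤ weilOddGroundEnergy (18 / 25 : ℝ)) (hUL₂ : (1 / 8000000000000 : ℝ) < L₂)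
    (hL₂ : L₂ ≤ weilOddGroundEnergy (3 / 4 : ℝ)) (hUL₃ : (1 / 14000000000000 : ℝ) < L₃)
    (hL₃ : L₃ ≤ weilOddGroundEnergy (77 / 100 : ℝ)) :
    ∀ a : ℝ, 0 < a → a ≤ 77 / 100 → WeilWindowSimpleEven a := by
  intro a ha hle
  rcases le_or_gt a (3 / 4) with h | h
  · exact weilWindowSimpleEven_of_le_M75_of_oddLower hUL₁ hL₁ hUL₂ hL₂ a ha h
  · exact weilWindowSimpleEven_on_cell_M77_of_oddLower hUL₃ hL₃ h.le hle

end Summit.RiemannHypothesis.RiemannHypothesis.Theorems.EvenWinsBeyondArch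

end
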